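import Mathlib
import Summits.ValiantsHypothesis.ValiantsHypothesis.Theorems.DivisionGapZeroOneTransferTriPMPowLowerBound

/-!
# Crux `DivisionGap.ZeroOneTransfer` (stmt-ValiantsHypothesis-5066), decisive instance `D_n`:
# SATURATED COFACTORS ARE NOT UNCHARGED CERTIFICATES — `L₊(D_n · X) ≥ (T/(T-1))^{(n-60)/24}` for EVERY torus-homogeneous
# `X` each of whose dimer covers carries a monomial of `X`, uniformly in `X`

Route `ValiantsHypothesis/FifoMatching` ∩ `DivisionGap`, helper toward the shared crux stmt-ValiantsHypothesis-5066 (`ZeroOneTransfer`),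
whose kill criterion is the decisive instance `D_n` (Valiant's rhombus/triangular dimers, `TriangularDimersDivisionEasy`):
`ZeroOneTransfer` — indeed already its UNCHARGED child `MonotoneMultiples` (line `charged-uncharged`, stub
`stub_monotoneMultiples`) — asks at `D_n` for a nonzero `X ≥ 0` with `L₊(D_n · X)` quasi-polynomial.  Part D-II of that line
(`DivisionGapZeroOneTransferTriPMPowLowerBound`, lead c12) killed the powers `X = D_n^M`.  This file kills, by the same typed
decomposition + gadget peeling, the whole class of

* TORUS-HOMOGENEOUS (`X` has one first-vertex margin vector `δ₁` and one second-vertex margin vector `δ₂`; free for monotone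
  circuits by vertex-potential initial forms) and
* **SATURATED** cofactors: every dimer cover `f` of the rhombus carries a monomial `e_f` of `X` supported on the cells `(v, f v)`
  (`e_f (v, w) ≠ 0 → f v = w`; multiplicities free) — e.g. `X = 1`, `D_n^M`, `Σ_f c_f μ_f^{k_f}` with all `c_f > 0`, any
  torus-homogeneous `X ≥ c · D_n^M` coefficientwise, products of such.

* `typed_of_cellSupported_mem_support_mul` — TYPE RIGIDITY in general form: if `p` is typed `(ρ, γ)` and a monomial `m`
  supported on the cells of the dimer cover `f` lies in `supp (p * q)`, then `γ (f x) = ρ x` for all `x`;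
* ★ `triPM_mul_saturated_lower_bound` — for even `n`, `24 L + 60 ≤ n`, and every torus-homogeneous saturated `X`:
  `T^L ≤ L₊(D_n · X) · (T-1)^L` (`T = 6^44`), i.e. `L₊(D_n · X) ≥ (T/(T-1))^L = 2^{Ω(n)}`, UNIFORMLY in `X` — MODULO the typed
  peeling package of Part D (hypothesis `hPeel` = `stub_typedGadgets` + `stub_forbiddenPeel`, landed on the computational lane;
  kept as a hypothesis so that this file stays on the standard axioms);
* ★★ `not_mm_certificate_saturated` — (same proviso) no constant `c` admits, for every `n`, a torus-homogeneous saturated `X_n`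
  with `L₊(D_n · X_n) ≤ 2^((log₂ n + c)^c)`: at the decisive instance, `MonotoneMultiples` has NO certificate in this class.

HONEST FRAMING: a support-based (Jerrum–Snir / Valiant 1980) negative for a CLASS of candidate certificates of the OPEN crux
5066 (through its child MM at `D_n`); the residual candidates are cofactors missing some dimer cover (e.g. the Kasteleyn-type
structured `X` the card hopes for); 5066, `TriangularDimersDivisionEasy`, `NNNotVP`, VP ≠ VNP all remain OPEN (NOT proved).
Twin of `Theorems/FifoMatchingNNSaturatedCofactors.lean` (queue family).

References: L. G. Valiant, *Negation can be exponentially powerful*, TCS 12 (1980) §3 Thm 1 [Valiant1980]; M. Jerrum, M. Snir,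
J. ACM 29 (1982) §3.1 Lemma 3.1, §4.3 [JerrumSnir1982]; S. Fomin, D. Grigoriev, G. Koshevoy, *Subtraction-free complexity,
cluster transformations, and spanning trees*, Found. Comput. Math. (2016) Remark 1.5 [FominGrigorievKoshevoy2014].
-/

noncomputable section

-- `Summit.ValiantsHypothesis.ValiantsHypothesis.…` is the tree's mandated single-conjunct layout (Sub = Summit).
set_option linter.dupNamespace false

namespace Summit.ValiantsHypothesis.ValiantsHypothesis.Theorems.DivisionGapZeroOneTransfer

open MvPolynomial
open Literature.Computability.AlgebraicComplexity
open Summit.ValiantsHypothesis.ValiantsHypothesis.Theorems.TriangularDimersDivisionEasy.Negative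
open scoped NNReal BigOperators

namespace TriPMSaturated

open TriPMPow

variable {n : ℕ}

/-! ### Margins of `D_n · X` and the served monomials -/

/-- Every monomial of `D_n · X`, `X` torus-homogeneous with margins `(δ₁, δ₂)`, has margins `(1 + δ₁, 1 + δ₂)`. [folklore] -/
theorem margins_triPM_mul {X : MvPolynomial ((Fin n × Fin n) × (Fin n × Fin n)) ℝ≥0} {δ₁ δ₂ : Fin n × Fin n → ℕ}
    (hX : ∀ e ∈ X.support, (∀ v, ∑ w, e (v, w) = δ₁ v) ∧ (∀ w, ∑ v, e (v, w) = δ₂ w)) :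
    ∀ α ∈ (triPM n * X).support, (∀ v, ∑ w, α (v, w) = 1 + δ₁ v) ∧ (∀ w, ∑ v, α (v, w) = 1 + δ₂ w) := by
  classical
  intro α hα
  obtain ⟨β, hβ, e, he, rfl⟩ := Finset.mem_add.mp (support_mul _ _ hα)
  obtain ⟨f, hf, rfl⟩ := (mem_support_triPM β).1 hβ
  have hfd : IsDimer f := (Finset.mem_filter.1 hf).2
  obtain ⟨hr, hc⟩ := hX e he
  refine ⟨fun v => ?_, fun w => ?_⟩
  · simp only [Finsupp.coe_add, Pi.add_apply, Finset.sum_add_distrib, hr v, rowSum_dimerExp f v]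
  · simp only [Finsupp.coe_add, Pi.add_apply, Finset.sum_add_distrib, hc w, colSum_dimerExp hfd w]

/-- The served monomial `μ_f + e_f` of a dimer cover lies in `supp (D_n · X)` (nothing cancels over `ℝ≥0`). [folklore] -/
theorem dimerExp_add_mem_support_mul {X : MvPolynomial ((Fin n × Fin n) × (Fin n × Fin n)) ℝ≥0}
    {f : Fin n × Fin n → Fin n × Fin n} (hf : f ∈ dimers n) {e : ((Fin n × Fin n) × (Fin n × Fin n)) →₀ ℕ}
    (he : e ∈ X.support) : dimerExp f + e ∈ (triPM n * X).support :=
  Literature.Computability.AlgebraicComplexity.add_mem_support_mul ((mem_support_triPM _).2 ⟨f, hf, rfl⟩) he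

/-! ### Type rigidity for cell-supported monomials -/

/-- **Type rigidity (general form).**  If every monomial of `p` has margins `(ρ, γ)` and a monomial `m` SUPPORTED ON THE CELLS
`(x, f x)` of a dimer cover `f` (`m (v, w) ≠ 0 → f v = w`) lies in `supp (p * q)`, then `γ (f x) = ρ x` for all `x`.
[cite: JerrumSnir1982, §3.1 Lemma 3.1] -/
theorem typed_of_cellSupported_mem_support_mul {p q : MvPolynomial ((Fin n × Fin n) × (Fin n × Fin n)) ℝ≥0}
    {ρ γ : Fin n × Fin n → ℕ}
    (hp : ∀ α ∈ p.support, (∀ v, ∑ w, α (v, w) = ρ v) ∧ (∀ w, ∑ v, α (v, w) = γ w))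
    {f : Fin n × Fin n → Fin n × Fin n} (hf : IsDimer f)
    {m : ((Fin n × Fin n) × (Fin n × Fin n)) →₀ ℕ} (hm : ∀ v w, m (v, w) ≠ 0 → f v = w)
    (hmem : m ∈ (p * q).support) : ∀ x, γ (f x) = ρ x := by
  classical
  obtain ⟨α, hα, β, -, hαβ⟩ := Finset.mem_add.mp (support_mul p q hmem)
  have hcell : ∀ v w, α (v, w) ≠ 0 → f v = w := by
    intro v w hvw
    have h := DFunLike.congr_fun hαβ (v, w)
    simp only [Finsupp.coe_add, Pi.add_apply] at h
    exact hm v w (by omega)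
  obtain ⟨hr, hc⟩ := hp α hα
  intro x
  have e1 : ∑ w, α (x, w) = α (x, f x) := by
    refine Finset.sum_eq_single (f x) (fun w _ hw => ?_) (by simp)
    by_contra h
    exact hw (hcell _ _ h).symm
  have e2 : ∑ v, α (v, f x) = α (x, f x) := by
    refine Finset.sum_eq_single x (fun v _ hv => ?_) (by simp)
    by_contra h
    have h1 := hcell v (f x) h
    exact hv (by rw [← (hf v).1, h1, (hf x).1])
  rw [← hr x, ← hc (f x), e1, e2]

end TriPMSaturated

open TriPMPow TriPMSaturated

/-- ★ **SATURATED TORUS-HOMOGENEOUS COFACTORS OF `D_n` ARE EXPONENTIALLY EXPENSIVE, UNIFORMLY — modulo the landed typed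
peeling.**  Hypothesis `hPeel` is the TYPED PEELING PACKAGE of Part D (for balanced `Z` and any `W`, the dimer covers with
`∀ x, x ∈ Z ↔ f x ∈ W` are at most a `((T-1)/T)^L` fraction, `24L + 60 ≤ n`): it is EXACTLY `stub_typedGadgets` (p157140) followed
by `stub_forbiddenPeel` (p157703), as assembled inside `triPM_pow_lower_bound`; it is kept as a hypothesis here only because
those landed stubs live on the computational lane (their gadget checks are `native_decide`), so that this file stays on the
standard axioms.  Conclusion: for even `n` and every `X` with constant margins `(δ₁, δ₂)` such that every dimer cover `f`
carries a monomial of `X` supported on its cells, `T^L ≤ L₊(D_n · X) · (T-1)^L`.  Typed row-support-balanced decomposition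
of `D_n · X` (margins `1 + δ`), capture of every cover by the product containing its served monomial `μ_f + e_f`, type
rigidity, peeling. [cite: Valiant1980, §3 Thm 1] [cite: JerrumSnir1982, §4.3] -/
theorem triPM_mul_saturated_lower_bound (n : ℕ) (he : Even n) (hn2 : 2 ≤ n)
    (hPeel : ∀ (Z W : Finset (Fin n × Fin n)), n * n < 3 * Z.card → 3 * Z.card ≤ 2 * (n * n) →
      ∀ L : ℕ, 24 * L + 60 ≤ n →
        Tfib ^ L * ((dimers n).filter (fun f => ∀ x : Fin n × Fin n, (x ∈ Z ↔ f x ∈ W))).card ≤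
          (Tfib - 1) ^ L * (dimers n).card)
    (L : ℕ) (hL : 24 * L + 60 ≤ n)
    (X : MvPolynomial ((Fin n × Fin n) × (Fin n × Fin n)) ℝ≥0) (δ₁ δ₂ : Fin n × Fin n → ℕ)
    (hX : ∀ e ∈ X.support, (∀ v, ∑ w, e (v, w) = δ₁ v) ∧ (∀ w, ∑ v, e (v, w) = δ₂ w))
    (hsat : ∀ f ∈ dimers n, ∃ e ∈ X.support, ∀ v w, e (v, w) ≠ 0 → f v = w) :
    Tfib ^ L ≤ complexity (triPM n * X) * (Tfib - 1) ^ L := by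
  classical
  -- typed balanced decomposition of `D_n · X`
  obtain ⟨s, hs, a, b, hsum, htyp⟩ := stub_dimerTypedDecomposition n hn2 (triPM n * X)
    (fun v => 1 + δ₁ v) (fun w => 1 + δ₂ w) (margins_triPM_mul hX) (fun _ => by omega)
  -- the served monomial of each cover
  choose e heSupp hecell using hsat
  -- for each term, the served covers are few
  have hterm : ∀ t : Fin s,
      Tfib ^ L * ((dimers n).filter fun f =>
          ∃ hf : f ∈ dimers n, dimerExp f + e f hf ∈ (a t * b t).support).card ≤
        (Tfib - 1) ^ L * (dimers n).card := by
    intro t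
    obtain ⟨ρ, γ, hty, hb1, hb2⟩ := htyp t
    set Z : Finset (Fin n × Fin n) := Finset.univ.filter fun i => ρ i ≠ 0 with hZ
    set W : Finset (Fin n × Fin n) := Finset.univ.filter fun i => γ i ≠ 0 with hW
    have hsub : ((dimers n).filter fun f =>
          ∃ hf : f ∈ dimers n, dimerExp f + e f hf ∈ (a t * b t).support) ⊆
        (dimers n).filter fun f => ∀ x : Fin n × Fin n, (x ∈ Z ↔ f x ∈ W) := by
      intro f hf
      rw [Finset.mem_filter] at hf ⊢
      obtain ⟨hfmem, hfD, hfsupp⟩ := hf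
      refine ⟨hfmem, fun x => ?_⟩
      have hfd : IsDimer f := (Finset.mem_filter.1 hfmem).2
      have hm : ∀ v w, (dimerExp f + e f hfD) (v, w) ≠ 0 → f v = w := by
        intro v w hvw
        simp only [Finsupp.coe_add, Pi.add_apply, dimerExp_apply] at hvw
        by_cases h1 : f v = w
        · exact h1
        · rw [if_neg h1, zero_add] at hvw
          exact hecell f hfD v w hvw
      have key := typed_of_cellSupported_mem_support_mul hty hfd hm hfsupp x
      simp only [hZ, hW, Finset.mem_filter, Finset.mem_univ, true_and]
      rw [key]
    exact (Nat.mul_le_mul_left _ (Finset.card_le_card hsub)).trans (hPeel Z W hb1 hb2 L hL)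
  -- every cover is served by some term
  have hcov : dimers n ⊆ Finset.univ.biUnion fun t : Fin s =>
      (dimers n).filter fun f => ∃ hf : f ∈ dimers n, dimerExp f + e f hf ∈ (a t * b t).support := by
    intro f hf
    have hmem : dimerExp f + e f hf ∈ (triPM n * X).support := dimerExp_add_mem_support_mul hf (heSupp f hf)
    rw [hsum] at hmem
    obtain ⟨t, -, ht⟩ := Finset.mem_biUnion.1 (support_sum hmem)
    exact Finset.mem_biUnion.2 ⟨t, Finset.mem_univ _, Finset.mem_filter.2 ⟨hf, hf, ht⟩⟩
  have hcard : (dimers n).card ≤ ∑ t : Fin s,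
      ((dimers n).filter fun f => ∃ hf : f ∈ dimers n, dimerExp f + e f hf ∈ (a t * b t).support).card :=
    (Finset.card_le_card hcov).trans Finset.card_biUnion_le
  have hpos : 0 < (dimers n).card := Finset.card_pos.2 (dimers_nonempty he)
  have key : Tfib ^ L * (dimers n).card ≤ s * ((Tfib - 1) ^ L * (dimers n).card) := by
    calc Tfib ^ L * (dimers n).card
        ≤ Tfib ^ L * ∑ t : Fin s, ((dimers n).filter fun f =>
            ∃ hf : f ∈ dimers n, dimerExp f + e f hf ∈ (a t * b t).support).card := Nat.mul_le_mul_left _ hcard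
      _ = ∑ t : Fin s, Tfib ^ L * ((dimers n).filter fun f =>
            ∃ hf : f ∈ dimers n, dimerExp f + e f hf ∈ (a t * b t).support).card := by rw [Finset.mul_sum]
      _ ≤ ∑ _t : Fin s, (Tfib - 1) ^ L * (dimers n).card := Finset.sum_le_sum fun t _ => hterm t
      _ = s * ((Tfib - 1) ^ L * (dimers n).card) := by simp
  have key2 : Tfib ^ L ≤ s * (Tfib - 1) ^ L := by
    have : Tfib ^ L * (dimers n).card ≤ (s * (Tfib - 1) ^ L) * (dimers n).card := by
      rw [mul_assoc]; exact key
    exact Nat.le_of_mul_le_mul_right this hpos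
  exact key2.trans (Nat.mul_le_mul_right _ hs)

/-- ★★ **No torus-homogeneous SATURATED cofactor is an uncharged certificate for `D_n` — modulo the typed peeling package**
(`MonotoneMultiples` at the decisive instance, restricted to this class): if the typed peeling holds at every `n = 2^m`,
`m ≥ 6` (it does: `stub_typedGadgets` + `stub_forbiddenPeel`, computational lane), then no constant `c` gives, for every `n`, a
torus-homogeneous `X` served on every dimer cover with `L₊(D_n · X) ≤ 2^((log₂ n + c)^c)`.
[cite: Valiant1980, §3 Thm 1] [cite: FominGrigorievKoshevoy2014, Remark 1.5] -/
theorem not_mm_certificate_saturated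
    (hPeel : ∀ m : ℕ, 6 ≤ m → ∀ (Z W : Finset (Fin (2 ^ m) × Fin (2 ^ m))),
      2 ^ m * 2 ^ m < 3 * Z.card → 3 * Z.card ≤ 2 * (2 ^ m * 2 ^ m) → ∀ L : ℕ, 24 * L + 60 ≤ 2 ^ m →
        Tfib ^ L * ((dimers (2 ^ m)).filter (fun f => ∀ x : Fin (2 ^ m) × Fin (2 ^ m), (x ∈ Z ↔ f x ∈ W))).card ≤
          (Tfib - 1) ^ L * (dimers (2 ^ m)).card) :
    ¬ ∃ c : ℕ, ∀ n : ℕ, ∃ (X : MvPolynomial ((Fin n × Fin n) × (Fin n × Fin n)) ℝ≥0)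
        (δ₁ δ₂ : Fin n × Fin n → ℕ),
      (∀ e ∈ X.support, (∀ v, ∑ w, e (v, w) = δ₁ v) ∧ (∀ w, ∑ v, e (v, w) = δ₂ w)) ∧
      (∀ f ∈ dimers n, ∃ e ∈ X.support, ∀ v w, e (v, w) ≠ 0 → f v = w) ∧
      complexity (triPM n * X) ≤ bound c n := by
  rintro ⟨c, H⟩
  obtain ⟨m, hm6, hviol⟩ := exists_m_violating c
  obtain ⟨X, δ₁, δ₂, hX, hsat, hle⟩ := H (2 ^ m)
  have he : Even (2 ^ m) := Nat.even_pow.2 ⟨even_two, by omega⟩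
  have h2 : 2 ≤ 2 ^ m := by
    calc 2 = 2 ^ 1 := by norm_num
      _ ≤ 2 ^ m := Nat.pow_le_pow_right (by norm_num) (by omega)
  have hlog : Nat.log 2 (2 ^ m) = m := Nat.log_pow (by norm_num) _
  have hF : complexity (triPM (2 ^ m) * X) ≤ 2 ^ ((m + c) ^ c) := by
    unfold bound at hle; rw [hlog] at hle; exact hle
  have hlb : ∀ L, 24 * L + 60 ≤ 2 ^ m →
      Tfib ^ L ≤ 4 * complexity (triPM (2 ^ m) * X) * (2 ^ m * 2 ^ m + 1) ^ 2 * (Tfib - 1) ^ L := by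
    intro L hL'
    have h1 := triPM_mul_saturated_lower_bound (2 ^ m) he h2 (hPeel m hm6) L hL' X δ₁ δ₂ hX hsat
    refine h1.trans (Nat.mul_le_mul_right _ ?_)
    have h3 : 1 ≤ (2 ^ m * 2 ^ m + 1) ^ 2 := Nat.one_le_pow _ _ (by omega)
    calc complexity (triPM (2 ^ m) * X) = 1 * complexity (triPM (2 ^ m) * X) * 1 := by ring
      _ ≤ 4 * complexity (triPM (2 ^ m) * X) * (2 ^ m * 2 ^ m + 1) ^ 2 :=
          Nat.mul_le_mul (Nat.mul_le_mul_right _ (by norm_num)) h3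
  have hkey := key_ineq_of_bound hm6 hlb hF
  exact absurd (hkey.trans_lt hviol) (lt_irrefl _)

end Summit.ValiantsHypothesis.ValiantsHypothesis.Theorems.DivisionGapZeroOneTransfer
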